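/- EXTRA WIDTH seat `ym-line-cbag-p1-w4` (g8), LINE 7 `GlueballBandRecursion`, in support of ⟨stmt-QuantumFields-22957⟩
`OneParticleBlochSymbolFamily`: the Hilbert-space side of the planner's stub S2 `stub_blochSymbolOfCovariantFamily` (STUB-PLAN
2026-08-28T18:17Z) — a translation-covariant orthonormal family spanning an invariant subspace of an operator has a translation-invariant
hopping matrix, whose Bloch symbols carry the trace of the powers of the operator on that subspace.  Route-independent; definition-free. -/
import Summits.QuantumFields.YangMills.Theorems.GlueballBandRecursionBlochReduction
import Mathlib.Analysis.InnerProductSpace.Orthonormal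

/-!
# Route `GlueballBandRecursion`: Bloch symbols of a translation-covariant orthonormal family

Companion of `Theorems/GlueballBandRecursionBlochReduction.lean` (the matrix algebra).  Here: an inner product space `E` over `𝕜 = ℝ` or
`ℂ`, an endomorphism `T`, and a finite orthonormal family `e : ι → E` whose span is `T`-invariant.

* §0 complements to the matrix file: left intertwining `Fᴴ M = blockDiagonal B · Fᴴ`, Bloch coefficients, and the EIGENVALUE
  CORRESPONDENCE `(∃ v ≠ 0, M v = μ v) ↔ ∃ p, ∃ u ≠ 0, B p u = μ u` (`exists_eigenvector_iff`) — the band's eigenvalues are exactly the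
  eigenvalues of the symbols at the lattice momenta (what (P1)/(P3) of `EffectiveBlochSymbolFamily` are about).
* §1 (any `𝕜`, any finite `ι`) the hopping matrix `A i j = ⟪e i, T (e j)⟫` represents `T` on the span: `T (e j) = Σ_i A i j • e i`
  (`apply_eq_sum_inner_smul`), `T^t (e j) = Σ_i (A^t) i j • e i`, `⟪e i, T^t (e j)⟫ = (A^t) i j`, `Σ_i ⟪e i, T^t (e i)⟫ = tr A^t`
  (`sum_inner_pow_apply_eq_trace_pow`); `T` symmetric ⇒ `A` Hermitian; eigenvectors: `T v = μ v ⇒ T^t v = μ^t v`.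
* §2 (index `ι = (Fin N)³ × Fin n`) translation covariance `e (x + a, j) = U_a (e (x, j))` for inner-product-preserving maps `U_a` commuting
  with `T` makes `A` translation-invariant (`inner_apply_translate`), so the block-circulant reduction applies: over `ℝ` (the tree's transfer
  matrix acts on a REAL `L²`), with the complex symbols `B p j k = Σ_x ⟪e (x, j), T (e (0, k))⟫ conj χ_p(x)`,
  **`Σ_i ⟪e i, T^t (e i)⟫ = Σ_p tr (B p)^t`** (`sum_inner_pow_apply_eq_sum_trace_symbol_pow`) and, for symmetric `T`, every `B p` is Hermitian
  (`isHermitian_symbol_of_symmetric`).  This is the content of stub S2 for whatever covariant family stub S1 delivers: the left side is the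
  trace of `T^t` on the band subspace (`= Σ_band λ^t` when the family consists of eigenvectors, `inner_pow_apply_of_apply_eq_smul`), the right
  side is the momentum sum of `EffectiveBlochSymbolFamily` once `B p = B̃(latticeAngle N p)`.

Sources: folklore (matrix of an operator in an orthonormal basis; discrete Bloch theorem).  Deliberately NOT here: existence of a covariant
family for a given invariant subspace (needs the subspace to be `n` copies of the regular representation of the translations — stub S1's
output), the transfer matrix, smoothness of the symbol.

HONEST FRAMING.  Linear algebra only; item 22957, the rung `ColdDoublingRecursionStrongCoupling` and the Yang–Mills mass gap are NOT proved
or advanced here.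
-/

set_option autoImplicit false

noncomputable section

open Finset Matrix Complex
open scoped InnerProductSpace

namespace Summit.QuantumFields.YangMills.Theorems.GlueballBandRecursion.Bloch

open Summit.QuantumFields.YangMills.Theorems.GlueballBandRecursion.Band (coordsF latticeAngle)

/-! ## §0 Complements to the matrix algebra: left intertwining and the eigenvalue correspondence -/

section MatrixComplements

variable {N : ℕ} [NeZero N] {n : ℕ}
variable (χ : (Fin N × Fin N × Fin N) → (Fin N × Fin N × Fin N) → ℂ)
  (hχ : ∀ p x, χ p x = Complex.exp (((∑ i : Fin 3, latticeAngle N p i * ((coordsF x i).val : ℝ) : ℝ) : ℂ) * Complex.I))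
  (M : Matrix ((Fin N × Fin N × Fin N) × Fin n) ((Fin N × Fin N × Fin N) × Fin n) ℂ)
  (hM : ∀ a x y j k, M (x + a, j) (y + a, k) = M (x, j) (y, k))
  (B : (Fin N × Fin N × Fin N) → Matrix (Fin n) (Fin n) ℂ)
  (hB : ∀ p j k, B p j k = ∑ x, M (x, j) (0, k) * star (χ p x))
  (F : Matrix ((Fin N × Fin N × Fin N) × Fin n) (Fin n × (Fin N × Fin N × Fin N)) ℂ)
  (hF : ∀ x j k p, F (x, j) (k, p) = if j = k then χ p x else 0)
include hχ hM hB hF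

/-- **Left intertwining** `Fᴴ M = blockDiagonal B · Fᴴ`: the Bloch coefficients `Fᴴ v` of `M v` are the symbols applied to the Bloch
coefficients of `v` (no Hermitian hypothesis). [folklore] -/
theorem conjTranspose_blochMatrix_mul : Fᴴ * M = Matrix.blockDiagonal B * Fᴴ := by
  have hN : ((N : ℂ) ^ 3) ≠ 0 := pow_ne_zero _ (Nat.cast_ne_zero.2 (NeZero.ne N))
  have h1 : Fᴴ * M * (F * Fᴴ) = Fᴴ * F * Matrix.blockDiagonal B * Fᴴ := by
    rw [← Matrix.mul_assoc, Matrix.mul_assoc Fᴴ M F, mul_blochMatrix χ hχ M hM B hB F hF, ← Matrix.mul_assoc]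
  rw [blochMatrix_mul_conjTranspose χ hχ F hF, conjTranspose_blochMatrix_mul_self χ hχ F hF, Matrix.mul_smul, Matrix.mul_one,
    Matrix.smul_mul, Matrix.smul_mul, Matrix.one_mul] at h1
  exact smul_right_injective _ hN h1

omit [NeZero N] hχ hM hB in
/-- Bloch coefficients: `(Fᴴ v) (k, p) = Σ_x conj χ_p(x) · v (x, k)`. [folklore] -/
theorem conjTranspose_blochMatrix_mulVec (v : (Fin N × Fin N × Fin N) × Fin n → ℂ) (k : Fin n) (p : Fin N × Fin N × Fin N) :
    (Fᴴ *ᵥ v) (k, p) = ∑ x, star (χ p x) * v (x, k) := by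
  rw [Matrix.mulVec, dotProduct, Fintype.sum_prod_type]
  refine Finset.sum_congr rfl fun x _ => ?_
  rw [Finset.sum_eq_single k (fun k' _ hk' => by rw [Matrix.conjTranspose_apply, hF, if_neg hk', star_zero, zero_mul])
    (fun h => (h (Finset.mem_univ k)).elim), Matrix.conjTranspose_apply, hF, if_pos rfl]

omit [NeZero N] hχ hM hB hF in
/-- The block-diagonal matrix acts blockwise: `(blockDiagonal B w) (k, p) = (B p (w (·, p))) k`. [folklore] -/
theorem blockDiagonal_mulVec_apply (w : Fin n × (Fin N × Fin N × Fin N) → ℂ) (k : Fin n) (p : Fin N × Fin N × Fin N) :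
    (Matrix.blockDiagonal B *ᵥ w) (k, p) = (B p *ᵥ fun k' => w (k', p)) k := by
  rw [Matrix.mulVec, dotProduct, Fintype.sum_prod_type, Matrix.mulVec, dotProduct]
  refine Finset.sum_congr rfl fun k' _ => ?_
  rw [Finset.sum_eq_single p (fun p' _ hp' => by rw [Matrix.blockDiagonal_apply_ne _ _ _ (Ne.symm hp'), zero_mul])
    (fun h => (h (Finset.mem_univ p)).elim), Matrix.blockDiagonal_apply_eq]

omit hM hB in
/-- `F Fᴴ = N³` makes `Fᴴ` injective: `Fᴴ v = 0 ⇒ v = 0`. [folklore] -/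
theorem eq_zero_of_conjTranspose_blochMatrix_mulVec_eq_zero (v : (Fin N × Fin N × Fin N) × Fin n → ℂ) (h0 : Fᴴ *ᵥ v = 0) : v = 0 := by
  have hN : ((N : ℂ) ^ 3) ≠ 0 := pow_ne_zero _ (Nat.cast_ne_zero.2 (NeZero.ne N))
  have h1 : F *ᵥ (Fᴴ *ᵥ v) = ((N : ℂ) ^ 3) • v := by
    rw [Matrix.mulVec_mulVec, blochMatrix_mul_conjTranspose χ hχ F hF, Matrix.smul_mulVec, Matrix.one_mulVec]
  rw [h0, Matrix.mulVec_zero] at h1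
  exact (smul_eq_zero.1 h1.symm).resolve_left hN

/-- **Eigenvalue correspondence, hard direction**: an eigenvector of `M` with eigenvalue `μ` yields, at some momentum `p`, an eigenvector of the
symbol `B p` with the same eigenvalue (its non-vanishing Bloch component). [folklore] -/
theorem exists_symbol_eigenvector_of_eigenvector (μ : ℂ) (v : (Fin N × Fin N × Fin N) × Fin n → ℂ) (hv : v ≠ 0) (hMv : M *ᵥ v = μ • v) :
    ∃ p : Fin N × Fin N × Fin N, ∃ u : Fin n → ℂ, u ≠ 0 ∧ B p *ᵥ u = μ • u := by
  have hw : Matrix.blockDiagonal B *ᵥ (Fᴴ *ᵥ v) = μ • (Fᴴ *ᵥ v) := by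
    rw [Matrix.mulVec_mulVec, ← conjTranspose_blochMatrix_mul χ hχ M hM B hB F hF, ← Matrix.mulVec_mulVec, hMv, Matrix.mulVec_smul]
  have hw0 : Fᴴ *ᵥ v ≠ 0 := fun h0 => hv (eq_zero_of_conjTranspose_blochMatrix_mulVec_eq_zero χ hχ F hF v h0)
  obtain ⟨⟨k, p⟩, hkp⟩ := Function.ne_iff.1 hw0
  refine ⟨p, fun k' => (Fᴴ *ᵥ v) (k', p), fun h => hkp (by simpa using congrFun h k), ?_⟩
  funext k'
  have h := congrFun hw (k', p)
  rw [blockDiagonal_mulVec_apply B, Pi.smul_apply] at h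
  rw [h, Pi.smul_apply]

/-- **Eigenvalue correspondence**: `μ` is an eigenvalue of the translation-invariant matrix `M` iff it is an eigenvalue of one of its Bloch
symbols `B p` (easy direction: the Bloch wave `χ_p ⊗ u`). [folklore] -/
theorem exists_eigenvector_iff (μ : ℂ) :
    (∃ v : (Fin N × Fin N × Fin N) × Fin n → ℂ, v ≠ 0 ∧ M *ᵥ v = μ • v) ↔
      ∃ p : Fin N × Fin N × Fin N, ∃ u : Fin n → ℂ, u ≠ 0 ∧ B p *ᵥ u = μ • u := by
  constructor
  · rintro ⟨v, hv, hMv⟩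
    exact exists_symbol_eigenvector_of_eigenvector χ hχ M hM B hB F hF μ v hv hMv
  · rintro ⟨p, u, hu, hBu⟩
    refine ⟨fun yk => χ p yk.1 * u yk.2, ?_, mulVec_blochWave_of_eigenvector χ hχ M hM B hB p u μ hBu⟩
    obtain ⟨k, hk⟩ := Function.ne_iff.1 hu
    refine Function.ne_iff.2 ⟨(0, k), ?_⟩
    simpa [char_zero_right χ hχ p] using hk

end MatrixComplements

/-! ## §1 The hopping matrix of an endomorphism on the span of an orthonormal family -/

section Hopping

variable {𝕜 : Type*} [RCLike 𝕜] {E : Type*} [NormedAddCommGroup E] [InnerProductSpace 𝕜 E]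
variable {ι : Type*} [Fintype ι]
variable (e : ι → E) (he : Orthonormal 𝕜 e) (T : E →ₗ[𝕜] E) (hinv : ∀ j, T (e j) ∈ Submodule.span 𝕜 (Set.range e))
include he hinv

/-- **The hopping matrix represents `T` on the span**: `T (e j) = Σ_i ⟪e i, T (e j)⟫ • e i` for an orthonormal family whose span is
`T`-invariant. [folklore] -/
theorem apply_eq_sum_inner_smul (j : ι) : T (e j) = ∑ i, ⟪e i, T (e j)⟫_𝕜 • e i := by
  obtain ⟨c, hc⟩ := (Submodule.mem_span_range_iff_exists_fun 𝕜).1 (hinv j)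
  have hci : ∀ i, ⟪e i, T (e j)⟫_𝕜 = c i := fun i => by rw [← hc, he.inner_right_fintype]
  simp_rw [hci]
  exact hc.symm

variable (A : Matrix ι ι 𝕜) (hA : ∀ i j, A i j = ⟪e i, T (e j)⟫_𝕜)
include hA

/-- The same with a named hopping matrix `A i j = ⟪e i, T (e j)⟫`: `T (e j) = Σ_i A i j • e i`. [folklore] -/
theorem apply_eq_sum_smul (j : ι) : T (e j) = ∑ i, A i j • e i := by
  simp_rw [hA]
  exact apply_eq_sum_inner_smul e he T hinv j

omit [Fintype ι] he hinv in
/-- A symmetric `T` (`⟪T v, w⟫ = ⟪v, T w⟫`) has a Hermitian hopping matrix. [folklore] -/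
theorem isHermitian_hopping (hT : ∀ v w : E, ⟪T v, w⟫_𝕜 = ⟪v, T w⟫_𝕜) : A.IsHermitian := by
  refine Matrix.IsHermitian.ext fun i j => ?_
  rw [hA, hA, ← inner_conj_symm, starRingEnd_apply, star_star, hT]

variable [DecidableEq ι]

/-- Powers: `T^t (e j) = Σ_i (A^t) i j • e i` with `A i j = ⟪e i, T (e j)⟫`. [folklore] -/
theorem pow_apply_eq_sum (t : ℕ) (j : ι) : (T ^ t) (e j) = ∑ i, (A ^ t) i j • e i := by
  induction t generalizing j with
  | zero =>
    rw [pow_zero, pow_zero, Module.End.one_apply]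
    simp only [Matrix.one_apply, ite_smul, one_smul, zero_smul, Finset.sum_ite_eq', Finset.mem_univ, if_true]
  | succ t ih =>
    rw [pow_succ', Module.End.mul_apply, ih, map_sum]
    simp_rw [map_smul, apply_eq_sum_smul e he T hinv A hA, Finset.smul_sum, smul_smul]
    rw [Finset.sum_comm]
    refine Finset.sum_congr rfl fun l _ => ?_
    rw [← Finset.sum_smul, pow_succ', Matrix.mul_apply]
    simp_rw [mul_comm (A l _)]

/-- Matrix elements of powers: `⟪e i, T^t (e j)⟫ = (A^t) i j`. [folklore] -/
theorem inner_pow_apply (t : ℕ) (i j : ι) : ⟪e i, (T ^ t) (e j)⟫_𝕜 = (A ^ t) i j := by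
  rw [pow_apply_eq_sum e he T hinv A hA, he.inner_right_fintype]

/-- **Trace of powers on the span**: `Σ_i ⟪e i, T^t (e i)⟫ = tr A^t`. [folklore] -/
theorem sum_inner_pow_apply_eq_trace_pow (t : ℕ) : ∑ i, ⟪e i, (T ^ t) (e i)⟫_𝕜 = (A ^ t).trace := by
  simp_rw [inner_pow_apply e he T hinv A hA]
  rfl

end Hopping

section Eigen

variable {𝕜 : Type*} [RCLike 𝕜] {E : Type*} [NormedAddCommGroup E] [InnerProductSpace 𝕜 E]

/-- Eigenvectors of `T` are eigenvectors of its powers: `T v = μ v ⇒ T^t v = μ^t v`. [folklore] -/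
theorem pow_apply_of_apply_eq_smul (T : E →ₗ[𝕜] E) (v : E) (μ : 𝕜) (hv : T v = μ • v) (t : ℕ) : (T ^ t) v = μ ^ t • v := by
  induction t with
  | zero => rw [pow_zero, pow_zero, Module.End.one_apply, one_smul]
  | succ t ih => rw [pow_succ', Module.End.mul_apply, ih, map_smul, hv, smul_smul, pow_succ, mul_comm]

/-- For a unit eigenvector, `⟪v, T^t v⟫ = μ^t` — so for an orthonormal family OF EIGENVECTORS the trace `Σ_i ⟪e i, T^t (e i)⟫` is the power sum
`Σ_i μ_i^t` of the band eigenvalues. [folklore] -/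
theorem inner_pow_apply_of_apply_eq_smul (T : E →ₗ[𝕜] E) (v : E) (hv1 : ‖v‖ = 1) (μ : 𝕜) (hv : T v = μ • v) (t : ℕ) :
    ⟪v, (T ^ t) v⟫_𝕜 = μ ^ t := by
  rw [pow_apply_of_apply_eq_smul T v μ hv t, inner_smul_right, inner_self_eq_norm_sq_to_K, hv1]
  simp

end Eigen

/-! ## §2 Translation-covariant families on `(Fin N)³ × Fin n` -/

section Covariant

variable {𝕜 : Type*} [RCLike 𝕜] {E : Type*} [NormedAddCommGroup E] [InnerProductSpace 𝕜 E]
variable {N : ℕ} {n : ℕ}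

/-- **Covariance ⇒ translation invariance of the hopping matrix**: if `e (x + a, j) = U_a (e (x, j))` with `U_a` preserving inner products and
commuting with `T`, then `⟪e (x + a, j), T (e (y + a, k))⟫ = ⟪e (x, j), T (e (y, k))⟫`.  (`U_a` need not be linear or surjective here; in the
application they are the Koopman isometries of the lattice translations, `Literature/…/WilsonTransferTranslations.lean`.) [folklore] -/
theorem inner_apply_translate (T : E →ₗ[𝕜] E) (U : (Fin N × Fin N × Fin N) → E → E)
    (hU : ∀ a v w, ⟪U a v, U a w⟫_𝕜 = ⟪v, w⟫_𝕜) (hUT : ∀ a v, T (U a v) = U a (T v))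
    (e : (Fin N × Fin N × Fin N) × Fin n → E) (hcov : ∀ x a j, e (x + a, j) = U a (e (x, j)))
    (a x y : Fin N × Fin N × Fin N) (j k : Fin n) :
    ⟪e (x + a, j), T (e (y + a, k))⟫_𝕜 = ⟪e (x, j), T (e (y, k))⟫_𝕜 := by
  rw [hcov, hcov, hUT, hU]

end Covariant

section Real

variable {E : Type*} [NormedAddCommGroup E] [InnerProductSpace ℝ E]
variable {N : ℕ} [NeZero N] {n : ℕ}
variable (χ : (Fin N × Fin N × Fin N) → (Fin N × Fin N × Fin N) → ℂ)
  (hχ : ∀ p x, χ p x = Complex.exp (((∑ i : Fin 3, latticeAngle N p i * ((coordsF x i).val : ℝ) : ℝ) : ℂ) * Complex.I))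
  (T : E →ₗ[ℝ] E) (U : (Fin N × Fin N × Fin N) → E → E)
  (hU : ∀ a v w, ⟪U a v, U a w⟫_ℝ = ⟪v, w⟫_ℝ) (hUT : ∀ a v, T (U a v) = U a (T v))
  (e : (Fin N × Fin N × Fin N) × Fin n → E) (he : Orthonormal ℝ e)
  (hcov : ∀ x a j, e (x + a, j) = U a (e (x, j)))
  (hinv : ∀ i, T (e i) ∈ Submodule.span ℝ (Set.range e))
  (B : (Fin N × Fin N × Fin N) → Matrix (Fin n) (Fin n) ℂ)
  (hB : ∀ p j k, B p j k = ∑ x, ((⟪e (x, j), T (e (0, k))⟫_ℝ : ℝ) : ℂ) * star (χ p x))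

include hχ hU hUT he hcov hinv hB

/-- **Stub S2, trace half**: for a translation-covariant orthonormal family spanning a `T`-invariant subspace of a REAL inner product space,
`Σ_i ⟪e i, T^t (e i)⟫ = Σ_p tr (B p)^t` with the Bloch symbols `B p j k = Σ_x ⟪e (x, j), T (e (0, k))⟫ conj χ_p(x)` — the trace of `T^t` on
the band subspace is the momentum sum of the traces of the `t`-th powers of the symbols. [folklore] -/
theorem sum_inner_pow_apply_eq_sum_trace_symbol_pow (t : ℕ) :
    (((∑ i, ⟪e i, (T ^ t) (e i)⟫_ℝ : ℝ)) : ℂ) = ∑ p, (B p ^ t).trace := by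
  classical
  obtain ⟨A, hA⟩ : ∃ A : Matrix ((Fin N × Fin N × Fin N) × Fin n) ((Fin N × Fin N × Fin N) × Fin n) ℝ,
      ∀ i l, A i l = ⟪e i, T (e l)⟫_ℝ := ⟨Matrix.of fun i l => ⟪e i, T (e l)⟫_ℝ, fun _ _ => rfl⟩
  obtain ⟨F, hF⟩ : ∃ F : Matrix ((Fin N × Fin N × Fin N) × Fin n) (Fin n × (Fin N × Fin N × Fin N)) ℂ,
      ∀ x j k p, F (x, j) (k, p) = if j = k then χ p x else 0 :=
    ⟨Matrix.of fun xj kp => if xj.2 = kp.1 then χ kp.2 xj.1 else 0, fun _ _ _ _ => rfl⟩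
  have hM : ∀ a x y j k, (A.map Complex.ofRealHom) (x + a, j) (y + a, k) = (A.map Complex.ofRealHom) (x, j) (y, k) :=
    fun a x y j k => by rw [Matrix.map_apply, Matrix.map_apply, hA, hA, inner_apply_translate T U hU hUT e hcov]
  have hB' : ∀ p j k, B p j k = ∑ x, (A.map Complex.ofRealHom) (x, j) (0, k) * star (χ p x) := fun p j k => by
    rw [hB]
    refine Finset.sum_congr rfl fun x _ => ?_
    rw [Matrix.map_apply, hA]
    rfl
  rw [sum_inner_pow_apply_eq_trace_pow e he T hinv A hA t,
    ← trace_pow_eq_sum_trace_symbol_pow χ hχ (A.map Complex.ofRealHom) hM B hB' F hF t, ← Matrix.map_pow,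
    ← AddMonoidHom.map_trace]
  rfl

omit he hinv in
/-- **Stub S2, Hermitian half**: for symmetric `T` every Bloch symbol `B p` of a covariant orthonormal family is Hermitian. [folklore] -/
theorem isHermitian_symbol_of_symmetric (hT : ∀ v w : E, ⟪T v, w⟫_ℝ = ⟪v, T w⟫_ℝ) (p : Fin N × Fin N × Fin N) : (B p).IsHermitian := by
  classical
  obtain ⟨A, hA⟩ : ∃ A : Matrix ((Fin N × Fin N × Fin N) × Fin n) ((Fin N × Fin N × Fin N) × Fin n) ℝ,
      ∀ i l, A i l = ⟪e i, T (e l)⟫_ℝ := ⟨Matrix.of fun i l => ⟪e i, T (e l)⟫_ℝ, fun _ _ => rfl⟩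
  have hM : ∀ a x y j k, (A.map Complex.ofRealHom) (x + a, j) (y + a, k) = (A.map Complex.ofRealHom) (x, j) (y, k) :=
    fun a x y j k => by rw [Matrix.map_apply, Matrix.map_apply, hA, hA, inner_apply_translate T U hU hUT e hcov]
  have hB' : ∀ p j k, B p j k = ∑ x, (A.map Complex.ofRealHom) (x, j) (0, k) * star (χ p x) := fun p j k => by
    rw [hB]
    refine Finset.sum_congr rfl fun x _ => ?_
    rw [Matrix.map_apply, hA]
    rfl
  have hAh : A.IsHermitian := isHermitian_hopping e T A hA hT
  have hMh : (A.map Complex.ofRealHom).IsHermitian := by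
    refine Matrix.IsHermitian.ext fun i l => ?_
    rw [Matrix.map_apply, Matrix.map_apply, ← hAh.apply i l]
    have h1 : star (A l i) = A l i := star_trivial _
    rw [h1]
    exact Complex.conj_ofReal _
  exact isHermitian_symbol χ hχ (A.map Complex.ofRealHom) hM B hB' hMh p

end Real

end Summit.QuantumFields.YangMills.Theorems.GlueballBandRecursion.Bloch

end
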